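import Mathlib.LinearAlgebra.Matrix.SchurComplement
import Summits.ValiantsHypothesis.ValiantsHypothesis.Theorems.PolyaContinuedMonotoneCoverHardOneLevelDet
import Summits.ValiantsHypothesis.ValiantsHypothesis.Theorems.PolyaContinuedMonotoneCoverHardBalExPure
import Literature.Computability.AlgebraicComplexity.MignonRessayreBound

/-!
# Crux `MonotoneCoverHard` (stmt-ValiantsHypothesis-7421), width line — FINITE TEST, part 2:
**no label-bijective Pfaffian cover of `per_n` (`n ≥ 3`) has a single variable level**

(val-width-7421-p3 g0, 2026-08-27.)  The director's first finite test of the width line — "do one-level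
Pfaffian covers of `per_3` / `per_4` exist at small `m`?" — is answered NO for every `m` and every
`n ≥ 3` (`no_oneLevel_pfaffian_cover`).  Statement: there is no cover `(m, E, a)` of `per_n` (labels in
`{X j, 0, 1}`, `per_n = aeval a PM_E`, `E` Pfaffian in the route's symbolic sense) with a level function
`g` on its used edges under which every variable edge leaves one and the same row level `ℓ₀` — i.e.
whose width profile is concentrated on one level (all `n` variable edges of every weight-nonzero
perfect matching "in parallel").  The trivial cover `K_{n,n}` and every Laplace-type cover are of this
kind (and indeed not Pfaffian); the theorem says no amount of idle wiring repairs this.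

Proof.  Part 1 (`…OneLevelDet.lean`): a Pólya signing `s` turns the cover into `per_n = det M`, `M` the
signed label matrix on the used edges.  Permute columns by a weight-nonzero `τ₀` (`M₁ = M ∘ τ₀`), and
split the rows into `A` (the `n` rows carrying the variable edges of `τ₀`), `B₀` (the other rows of
level `ℓ₀`) and `Z` (rows of other levels).  One-level forces: rows of `Z` emit no variable used edge,
and the `τ₀`-columns of `B₀` receive none; so `M₁[Z, ·]` and `M₁[·, B₀]` are CONSTANT and
`M₁[Z, B₀] = 0`, while the idle blocks `M₁[Z,Z]`, `M₁[B₀,B₀]` have determinant `±1`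
(`det_idleBlock_eq_prod`).  Two Schur-complement steps with these constant invertible pivots
(`det_eq_C_mul_det_schur`, degree bookkeeping `totalDegree_schur_le`) leave
`per_n = c · det L` with `c ∈ ℂˣ` and `L` an `A × A = n × n` matrix of affine-linear forms, i.e. an
affine determinantal representation of `per_n` of size `n`; Mignon–Ressayre
(`sq_le_two_mul_of_hasDetRepr_perPoly`, Literature) gives `n² ≤ 2n`, impossible for `n ≥ 3`.

Consequences for the line: the width bet's cheapest falsifier is dead at all sizes; combined with the
width-profile dichotomy, every label-bijective Pfaffian cover of `per_n`, `n ≥ 3`, has at least two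
variable levels.  VP ≠ VNP is not moved (nor is `MonotoneCoverHard`: this is the extreme-width end,
the bet concerns widths `n / polylog`).  No definitions.
-/

namespace Summit.ValiantsHypothesis.ValiantsHypothesis.Theorems.PolyaContinuedMonotoneCoverHard

-- summit = sub-problem name (single-conjunct summit, D-0017 layout), so the namespace repeats it
set_option linter.dupNamespace false

open scoped Classical
open Finset
open Literature.Combinatorics.SimpleGraph (IsPolyaSigning)
open Literature.Computability.AlgebraicComplexity (HasDetRepr sq_le_two_mul_of_hasDetRepr_perPoly)
open Summit.ValiantsHypothesis.ValiantsHypothesis.Theorems.PolyaContinued.MonotoneCoverHardRectangle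
  (exists_labels aeval_permanent_cover perPoly_eq_sum_monomial label_bijection pexp_injective)

/-- **Schur step with a constant invertible pivot.**  If the `p × p` block of a square matrix `N`
over `MvPolynomial σ ℂ` is the constant matrix `S` with `det S ≠ 0`, then
`det N = C (det S) · det (N[¬p,¬p] - N[¬p,p] S⁻¹ N[p,¬p])`. -/
theorem det_eq_C_mul_det_schur {ι : Type*} [Fintype ι] [DecidableEq ι] {σ : Type*}
    (N : Matrix ι ι (MvPolynomial σ ℂ)) (p : ι → Prop)
    (S : Matrix {i // p i} {i // p i} ℂ) (hdet : S.det ≠ 0)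
    (hS : ∀ i j : {i // p i}, N i j = MvPolynomial.C (S i j)) :
    N.det = MvPolynomial.C S.det *
      (Matrix.of fun (i j : {i // ¬ p i}) => N i j -
        ∑ l : {i // p i}, ∑ k : {i // p i},
          N i k * MvPolynomial.C (S⁻¹ k l) * N l j).det := by
  set e : {i // ¬ p i} ⊕ {i // p i} ≃ ι := (Equiv.sumComm _ _).trans (Equiv.sumCompl p) with he
  have he1 : ∀ i : {i // ¬ p i}, e (Sum.inl i) = i := fun i => by
    simp [he, Equiv.sumCompl_apply_inr]
  have he2 : ∀ i : {i // p i}, e (Sum.inr i) = i := fun i => by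
    simp [he, Equiv.sumCompl_apply_inl]
  set D : Matrix {i // p i} {i // p i} (MvPolynomial σ ℂ) :=
    (MvPolynomial.C : ℂ →+* MvPolynomial σ ℂ).mapMatrix S with hD
  have hblocks : N.submatrix e e = Matrix.fromBlocks
      (Matrix.of fun (i j : {i // ¬ p i}) => N i j) (Matrix.of fun (i : {i // ¬ p i}) (j : {i // p i}) => N i j)
      (Matrix.of fun (i : {i // p i}) (j : {i // ¬ p i}) => N i j) D := by
    ext (i | i) (j | j)
    · simp [Matrix.submatrix_apply, he1]
    · simp [Matrix.submatrix_apply, he1, he2]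
    · simp [Matrix.submatrix_apply, he1, he2]
    · simp [Matrix.submatrix_apply, he2, hD, hS]
  haveI : Invertible S := Matrix.invertibleOfIsUnitDet S (Ne.isUnit hdet)
  haveI hDinv : Invertible D := by
    rw [hD]; exact Invertible.map (MvPolynomial.C : ℂ →+* MvPolynomial σ ℂ).mapMatrix S
  have hinvD : ⅟D = (MvPolynomial.C : ℂ →+* MvPolynomial σ ℂ).mapMatrix S⁻¹ := by
    have h1 : D * (MvPolynomial.C : ℂ →+* MvPolynomial σ ℂ).mapMatrix S⁻¹ = 1 := by
      rw [hD, ← map_mul, Matrix.mul_nonsing_inv S (Ne.isUnit hdet), map_one]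
    calc ⅟D = ⅟D * (D * (MvPolynomial.C : ℂ →+* MvPolynomial σ ℂ).mapMatrix S⁻¹) := by
          rw [h1, Matrix.mul_one]
      _ = (MvPolynomial.C : ℂ →+* MvPolynomial σ ℂ).mapMatrix S⁻¹ := by
          rw [← Matrix.mul_assoc, invOf_mul_self, Matrix.one_mul]
  have hdetD : D.det = MvPolynomial.C S.det := by
    rw [hD, ← RingHom.map_det]
  rw [← Matrix.det_submatrix_equiv_self e N, hblocks, Matrix.det_fromBlocks₂₂, hdetD]
  congr 2
  ext i j
  simp only [Matrix.sub_apply, Matrix.of_apply, Matrix.mul_apply, hinvD, RingHom.mapMatrix_apply,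
    Matrix.map_apply, Finset.sum_mul]

/-- Degree bookkeeping for a Schur step: if all entries of `N` have total degree `≤ 1`, the columns
`p` of the rows `¬p` have degree `≤ dB`, the rows `p` (columns `¬p`) have degree `≤ dC`, and
`dB + dC ≤ 1`, then every entry of the Schur complement through a constant `p × p` matrix `T` has
total degree `≤ 1`. -/
theorem totalDegree_schur_le {ι : Type*} [Fintype ι] [DecidableEq ι] {σ : Type*}
    (N : Matrix ι ι (MvPolynomial σ ℂ)) (p : ι → Prop) (T : Matrix {i // p i} {i // p i} ℂ)
    (dB dC : ℕ) (hBC : dB + dC ≤ 1) (hN : ∀ i j, (N i j).totalDegree ≤ 1)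
    (hB : ∀ (i : {i // ¬ p i}) (k : {i // p i}), (N i k).totalDegree ≤ dB)
    (hC : ∀ (l : {i // p i}) (j : {i // ¬ p i}), (N l j).totalDegree ≤ dC) (i j : {i // ¬ p i}) :
    (N i j - ∑ l : {i // p i}, ∑ k : {i // p i},
        N i k * MvPolynomial.C (T k l) * N l j).totalDegree ≤ 1 := by
  refine (MvPolynomial.totalDegree_sub _ _).trans (max_le (hN i j) ?_)
  refine (MvPolynomial.totalDegree_finsetSum _ _).trans (Finset.sup_le fun l _ => ?_)
  refine (MvPolynomial.totalDegree_finsetSum _ _).trans (Finset.sup_le fun k _ => ?_)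
  calc (N i k * MvPolynomial.C (T k l) * N l j).totalDegree
      ≤ (N i k * MvPolynomial.C (T k l)).totalDegree + (N l j).totalDegree :=
        MvPolynomial.totalDegree_mul _ _
    _ ≤ ((N i k).totalDegree + (MvPolynomial.C (T k l) : MvPolynomial σ ℂ).totalDegree) +
          (N l j).totalDegree := Nat.add_le_add_right (MvPolynomial.totalDegree_mul _ _) _
    _ ≤ (dB + 0) + dC := by
        refine Nat.add_le_add (Nat.add_le_add (hB i k) ?_) (hC l j)
        rw [MvPolynomial.totalDegree_C]
    _ ≤ 1 := by omega

/-- **No label-bijective Pfaffian cover of `per_n`, `n ≥ 3`, has a single variable level.**  For a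
cover `(m, E, a)` of `per_n` with Pfaffian `E` (route's symbolic form) and a level function `g` on its
used edges (`hg`), it is impossible that every variable edge of every weight-nonzero perfect matching
leaves the same row level `ℓ₀` (`hlev`). -/
theorem no_oneLevel_pfaffian_cover (n m : ℕ) (hn : 3 ≤ n) (E : Finset (Fin m × Fin m))
    (a : Fin m × Fin m → MvPolynomial (Fin n × Fin n) ℂ)
    (hsig : ∃ s : Fin m × Fin m → ℂ, (∀ e, s e = 1 ∨ s e = -1) ∧
      (Matrix.of fun i j => if (i, j) ∈ E then MvPolynomial.C (s (i, j)) * MvPolynomial.X (i, j)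
          else 0 : Matrix (Fin m) (Fin m) (MvPolynomial (Fin m × Fin m) ℂ)).det =
        (Matrix.of fun i j => if (i, j) ∈ E then MvPolynomial.X (i, j) else 0 :
          Matrix (Fin m) (Fin m) (MvPolynomial (Fin m × Fin m) ℂ)).permanent)
    (ha : ∀ e, (∃ j, a e = MvPolynomial.X j) ∨ a e = 0 ∨ a e = 1)
    (hper : Literature.Computability.AlgebraicComplexity.perPoly (Fin n) ℂ =
      MvPolynomial.aeval a (Matrix.of fun i j => if (i, j) ∈ E then MvPolynomial.X (i, j) else 0 :
          Matrix (Fin m) (Fin m) (MvPolynomial (Fin m × Fin m) ℂ)).permanent)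
    (g : Fin m ⊕ Fin m → ℕ) (ℓ₀ : ℕ)
    (hg : ∀ τ : Equiv.Perm (Fin m), (∀ i, (i, τ i) ∈ E ∧ a (i, τ i) ≠ 0) → ∀ i,
      ((∃ k, a (i, τ i) = MvPolynomial.X k) → g (Sum.inr (τ i)) = g (Sum.inl i) + 1) ∧
      ((¬ ∃ k, a (i, τ i) = MvPolynomial.X k) → g (Sum.inr (τ i)) = g (Sum.inl i)))
    (hlev : ∀ τ : Equiv.Perm (Fin m), (∀ i, (i, τ i) ∈ E ∧ a (i, τ i) ≠ 0) → ∀ i,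
      (∃ k, a (i, τ i) = MvPolynomial.X k) → g (Sum.inl i) = ℓ₀) : False := by
  obtain ⟨n, rfl⟩ : ∃ k, n = k + 3 := ⟨n - 3, by omega⟩
  clear hn
  -- Pólya signing, signed label matrix, `det M = per`
  obtain ⟨s, hs⟩ := exists_polyaSigning_of_symbolic E hsig
  obtain ⟨M, hM⟩ : ∃ M : Matrix (Fin m) (Fin m) (MvPolynomial (Fin (n + 3) × Fin (n + 3)) ℂ),
      ∀ i j, M i j = if ∃ τ : Equiv.Perm (Fin m), (∀ k, (k, τ k) ∈ E ∧ a (k, τ k) ≠ 0) ∧ τ i = j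
        then MvPolynomial.C ((s (i, j) : ℤ) : ℂ) * a (i, j) else 0 :=
    ⟨fun i j => if ∃ τ : Equiv.Perm (Fin m), (∀ k, (k, τ k) ∈ E ∧ a (k, τ k) ≠ 0) ∧ τ i = j
        then MvPolynomial.C ((s (i, j) : ℤ) : ℂ) * a (i, j) else 0, fun _ _ => rfl⟩
  have hdetM := det_signedLabel_eq_perPoly E a hper s hs M hM
  -- a weight-nonzero perfect matching `τ₀` (the cover realises the identity permutation)
  obtain ⟨τ₀, hτ₀⟩ : ∃ τ₀ : Equiv.Perm (Fin m), ∀ i, (i, τ₀ i) ∈ E ∧ a (i, τ₀ i) ≠ 0 := by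
    obtain ⟨δ, hδ, -, -⟩ := exists_labels a ha
    set G := univ.filter fun τ : Equiv.Perm (Fin m) => ∀ i, (i, τ i) ∈ E ∧ a (i, τ i) ≠ 0 with hG
    have hsum : ∑ τ ∈ G, MvPolynomial.monomial (∑ i, δ (i, τ i)) (1 : ℂ) =
        ∑ σ : Equiv.Perm (Fin (n + 3)),
          MvPolynomial.monomial (∑ k, Finsupp.single (k, σ k) 1) (1 : ℂ) := by
      rw [← aeval_permanent_cover E a δ hδ G hG, ← hper, perPoly_eq_sum_monomial]
    obtain ⟨-, -, hsurj⟩ := label_bijection G (fun τ => ∑ i, δ (i, τ i))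
      (fun σ : Equiv.Perm (Fin (n + 3)) => ∑ k, Finsupp.single (k, σ k) (1 : ℕ)) pexp_injective hsum
    obtain ⟨τ, hτG, -⟩ := hsurj 1
    rw [hG] at hτG
    exact ⟨τ, (mem_filter.1 hτG).2⟩
  -- used edges: membership, labels and levels
  have hK1 : ∀ i j, (∃ τ : Equiv.Perm (Fin m), (∀ k, (k, τ k) ∈ E ∧ a (k, τ k) ≠ 0) ∧ τ i = j) →
      ((i, j) ∈ E ∧ a (i, j) ≠ 0) ∧
      ((∃ k, a (i, j) = MvPolynomial.X k) → g (Sum.inr j) = g (Sum.inl i) + 1 ∧ g (Sum.inl i) = ℓ₀) ∧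
      ((¬ ∃ k, a (i, j) = MvPolynomial.X k) → g (Sum.inr j) = g (Sum.inl i)) := by
    rintro i j ⟨τ, hτ, rfl⟩
    exact ⟨hτ i, fun hv => ⟨(hg τ hτ i).1 hv, hlev τ hτ i hv⟩, fun hv => (hg τ hτ i).2 hv⟩
  have hK2 : ∀ e, a e ≠ 0 → (¬ ∃ k, a e = MvPolynomial.X k) → a e = 1 := by
    intro e h1 h2
    rcases ha e with h | h | h
    · exact absurd h h2
    · exact absurd h h1
    · exact h
  have hunit : ∀ e, ((s e : ℤ) : ℂ) ≠ 0 := fun e => by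
    rcases Int.units_eq_one_or (s e) with h | h <;> simp [h]
  -- the column-permuted matrix `M₁ = M ∘ τ₀` and its constant companion `Sf`
  set M₁ : Matrix (Fin m) (Fin m) (MvPolynomial (Fin (n + 3) × Fin (n + 3)) ℂ) :=
    M.submatrix id τ₀ with hM₁def
  have hM₁ : ∀ i i', M₁ i i' =
      if ∃ τ : Equiv.Perm (Fin m), (∀ k, (k, τ k) ∈ E ∧ a (k, τ k) ≠ 0) ∧ τ i = τ₀ i'
      then MvPolynomial.C ((s (i, τ₀ i') : ℤ) : ℂ) * a (i, τ₀ i') else 0 := fun i i' => by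
    rw [hM₁def, Matrix.submatrix_apply]
    exact hM i (τ₀ i')
  have hdet₁ : M₁.det = ((Equiv.Perm.sign τ₀ : ℤ) : MvPolynomial (Fin (n + 3) × Fin (n + 3)) ℂ) *
      M.det := Matrix.det_permute' τ₀ M
  obtain ⟨Sf, hSf⟩ : ∃ Sf : Matrix (Fin m) (Fin m) ℂ, ∀ i i', Sf i i' =
      if ∃ τ : Equiv.Perm (Fin m), (∀ k, (k, τ k) ∈ E ∧ a (k, τ k) ≠ 0) ∧ τ i = τ₀ i'
      then ((s (i, τ₀ i') : ℤ) : ℂ) else 0 :=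
    ⟨fun i i' => if ∃ τ : Equiv.Perm (Fin m), (∀ k, (k, τ k) ∈ E ∧ a (k, τ k) ≠ 0) ∧ τ i = τ₀ i'
      then ((s (i, τ₀ i') : ℤ) : ℂ) else 0, fun _ _ => rfl⟩
  -- entries that cannot be variable are constant
  have hconst : ∀ i i',
      ((∃ τ : Equiv.Perm (Fin m), (∀ k, (k, τ k) ∈ E ∧ a (k, τ k) ≠ 0) ∧ τ i = τ₀ i') →
        ¬ ∃ k, a (i, τ₀ i') = MvPolynomial.X k) →
      M₁ i i' = MvPolynomial.C (Sf i i') := by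
    intro i i' h
    rw [hM₁, hSf]
    split_ifs with hu
    · rw [hK2 _ (hK1 _ _ hu).1.2 (h hu), mul_one]
    · exact MvPolynomial.C_0.symm
  -- all entries are affine-linear
  have hdeg : ∀ i i', (M₁ i i').totalDegree ≤ 1 := by
    intro i i'
    rw [hM₁]
    split_ifs with hu
    · by_cases hv : ∃ k, a (i, τ₀ i') = MvPolynomial.X k
      · obtain ⟨k, hk⟩ := hv
        rw [hk]
        calc (MvPolynomial.C ((s (i, τ₀ i') : ℤ) : ℂ) * MvPolynomial.X k).totalDegree
            ≤ (MvPolynomial.C ((s (i, τ₀ i') : ℤ) : ℂ) :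
                MvPolynomial (Fin (n + 3) × Fin (n + 3)) ℂ).totalDegree +
              (MvPolynomial.X k : MvPolynomial (Fin (n + 3) × Fin (n + 3)) ℂ).totalDegree :=
              MvPolynomial.totalDegree_mul _ _
          _ ≤ 0 + 1 := Nat.add_le_add (le_of_eq (MvPolynomial.totalDegree_C _))
              (MvPolynomial.totalDegree_X k).le
          _ = 1 := rfl
      · rw [hK2 _ (hK1 _ _ hu).1.2 hv, mul_one, MvPolynomial.totalDegree_C]
        exact Nat.zero_le _
    · rw [MvPolynomial.totalDegree_zero]
      exact Nat.zero_le _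
  -- rows off level `ℓ₀` emit only constant entries
  have hZrow : ∀ i i', g (Sum.inl i) ≠ ℓ₀ → M₁ i i' = MvPolynomial.C (Sf i i') :=
    fun i i' hi => hconst i i' fun hu hv => hi ((hK1 _ _ hu).2.1 hv).2
  -- the `τ₀`-column of a row with a non-variable `τ₀`-edge sits on the row's level
  have hcolB : ∀ j, (¬ ∃ k, a (j, τ₀ j) = MvPolynomial.X k) → g (Sum.inr (τ₀ j)) = g (Sum.inl j) :=
    fun j hv => (hK1 j (τ₀ j) ⟨τ₀, hτ₀, rfl⟩).2.2 hv
  -- rows off level `ℓ₀` have no used edge into the `τ₀`-columns of `B₀`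
  have hZB0 : ∀ i j, g (Sum.inl i) ≠ ℓ₀ → g (Sum.inl j) = ℓ₀ →
      (¬ ∃ k, a (j, τ₀ j) = MvPolynomial.X k) → M₁ i j = 0 := by
    intro i j hi hj hv
    rw [hM₁, if_neg]
    rintro hu
    have h1 := hcolB j hv
    rcases Classical.em (∃ k, a (i, τ₀ j) = MvPolynomial.X k) with hv' | hv'
    · exact hi ((hK1 _ _ hu).2.1 hv').2
    · have h2 := (hK1 _ _ hu).2.2 hv'
      exact hi (by rw [← h2, h1, hj])
  -- level-`ℓ₀` rows into the `τ₀`-columns of `B₀`: constant entries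
  have hAB0 : ∀ i j, g (Sum.inl i) = ℓ₀ → g (Sum.inl j) = ℓ₀ →
      (¬ ∃ k, a (j, τ₀ j) = MvPolynomial.X k) → M₁ i j = MvPolynomial.C (Sf i j) := by
    intro i j hi hj hv
    refine hconst i j fun hu hv' => ?_
    have h1 := hcolB j hv
    have h2 := ((hK1 _ _ hu).2.1 hv').1
    omega
  /- STEP 1: Schur complement through the idle block `Z × Z`, `Z` = rows of level `≠ ℓ₀`. -/
  obtain ⟨p₁, hp₁⟩ : ∃ p₁ : Fin m → Prop, ∀ i, p₁ i ↔ g (Sum.inl i) ≠ ℓ₀ := ⟨_, fun _ => Iff.rfl⟩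
  have hnp₁ : ∀ j : {i // ¬ p₁ i}, g (Sum.inl (j : Fin m)) = ℓ₀ := fun j => by
    by_contra h; exact j.2 ((hp₁ _).2 h)
  set S₁ : Matrix {i // p₁ i} {i // p₁ i} ℂ := Matrix.of fun i i' => Sf i i' with hS₁
  have hS₁det : S₁.det = ∏ i : {i // p₁ i}, ((s ((i : Fin m), τ₀ i) : ℤ) : ℂ) :=
    det_idleBlock_eq_prod E a ha hper s τ₀ hτ₀ p₁ (fun i hi hv => (hp₁ i).1 hi (hlev τ₀ hτ₀ i hv))
      (fun i i' hi _ hu hv => (hp₁ i).1 hi ((hK1 _ _ hu).2.1 hv).2) S₁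
      (fun i i' => by rw [hS₁, Matrix.of_apply, hSf])
  have hS₁ne : S₁.det ≠ 0 := by
    rw [hS₁det]
    exact Finset.prod_ne_zero_iff.2 fun i _ => hunit _
  have hstep1 := det_eq_C_mul_det_schur M₁ p₁ S₁ hS₁ne
    (fun i j => by rw [hS₁, Matrix.of_apply]; exact hZrow i j ((hp₁ _).1 i.2))
  set N' : Matrix {i // ¬ p₁ i} {i // ¬ p₁ i} (MvPolynomial (Fin (n + 3) × Fin (n + 3)) ℂ) :=
    Matrix.of fun (i j : {i // ¬ p₁ i}) => M₁ i j -
      ∑ l : {i // p₁ i}, ∑ k : {i // p₁ i}, M₁ i k * MvPolynomial.C (S₁⁻¹ k l) * M₁ l j with hN'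
  have hN'deg : ∀ i j, (N' i j).totalDegree ≤ 1 := fun i j => by
    rw [hN', Matrix.of_apply]
    exact totalDegree_schur_le M₁ p₁ S₁⁻¹ 1 0 (by norm_num) hdeg (fun i k => hdeg i k)
      (fun l j => le_of_eq (by rw [hZrow l j ((hp₁ _).1 l.2), MvPolynomial.totalDegree_C])) i j
  -- the `B₀`-columns of `N'` are those of `M₁` (the correction vanishes there)
  have hN'B0 : ∀ (i j : {i // ¬ p₁ i}), (¬ ∃ k, a ((j : Fin m), τ₀ j) = MvPolynomial.X k) →
      N' i j = M₁ i j := by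
    intro i j hv
    rw [hN', Matrix.of_apply, sub_eq_self]
    refine Finset.sum_eq_zero fun l _ => Finset.sum_eq_zero fun k _ => ?_
    rw [hZB0 l j ((hp₁ _).1 l.2) (hnp₁ j) hv, mul_zero]
  /- STEP 2: Schur complement through the idle block `B₀ × B₀` of `N'`. -/
  obtain ⟨p₂, hp₂⟩ : ∃ p₂ : {i // ¬ p₁ i} → Prop,
      ∀ i, p₂ i ↔ ¬ ∃ k, a ((i : Fin m), τ₀ i) = MvPolynomial.X k := ⟨_, fun _ => Iff.rfl⟩
  set S₂ : Matrix {i // p₂ i} {i // p₂ i} ℂ := Matrix.of fun i i' => Sf i i' with hS₂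
  have hS₂N : ∀ i j : {i : {i // ¬ p₁ i} // p₂ i}, N' i j = MvPolynomial.C (S₂ i j) := by
    intro i j
    rw [hS₂, Matrix.of_apply, hN'B0 _ _ ((hp₂ _).1 j.2)]
    exact hAB0 _ _ (hnp₁ i.1) (hnp₁ j.1) ((hp₂ _).1 j.2)
  obtain ⟨B0, hB0⟩ : ∃ B0 : Fin m → Prop,
      ∀ i, B0 i ↔ g (Sum.inl i) = ℓ₀ ∧ ¬ ∃ k, a (i, τ₀ i) = MvPolynomial.X k := ⟨_, fun _ => Iff.rfl⟩
  set SB : Matrix {i // B0 i} {i // B0 i} ℂ := Matrix.of fun i i' => Sf i i' with hSB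
  have hSBdet : SB.det = ∏ i : {i // B0 i}, ((s ((i : Fin m), τ₀ i) : ℤ) : ℂ) :=
    det_idleBlock_eq_prod E a ha hper s τ₀ hτ₀ B0 (fun i hi => ((hB0 i).1 hi).2)
      (fun i i' hi hi' hu hv => by
        have h1 := hcolB i' ((hB0 i').1 hi').2
        have h2 := (hK1 _ _ hu).2.1 hv
        have h3 := ((hB0 i).1 hi).1
        have h4 := ((hB0 i').1 hi').1
        omega)
      SB (fun i i' => by rw [hSB, Matrix.of_apply, hSf])
  let e₂ : {i : {i // ¬ p₁ i} // p₂ i} ≃ {i // B0 i} :=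
    { toFun := fun x => ⟨x.1.1, (hB0 _).2 ⟨hnp₁ x.1, (hp₂ _).1 x.2⟩⟩
      invFun := fun y => ⟨⟨y.1, fun h => (hp₁ _).1 h ((hB0 _).1 y.2).1⟩, (hp₂ _).2 ((hB0 _).1 y.2).2⟩
      left_inv := fun x => rfl
      right_inv := fun y => rfl }
  have hS₂eq : S₂ = SB.submatrix e₂ e₂ := by
    ext x y; rfl
  have hS₂ne : S₂.det ≠ 0 := by
    rw [hS₂eq, Matrix.det_submatrix_equiv_self, hSBdet]
    exact Finset.prod_ne_zero_iff.2 fun i _ => hunit _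
  have hstep2 := det_eq_C_mul_det_schur N' p₂ S₂ hS₂ne hS₂N
  set L : Matrix {i : {i // ¬ p₁ i} // ¬ p₂ i} {i : {i // ¬ p₁ i} // ¬ p₂ i}
      (MvPolynomial (Fin (n + 3) × Fin (n + 3)) ℂ) :=
    Matrix.of fun (i j : {i : {i // ¬ p₁ i} // ¬ p₂ i}) => N' i j -
      ∑ l : {i // p₂ i}, ∑ k : {i // p₂ i}, N' i k * MvPolynomial.C (S₂⁻¹ k l) * N' l j with hL
  have hLdeg : ∀ i j, (L i j).totalDegree ≤ 1 := fun i j => by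
    rw [hL, Matrix.of_apply]
    exact totalDegree_schur_le N' p₂ S₂⁻¹ 0 1 (by norm_num) hN'deg
      (fun i k => le_of_eq (by
        rw [hN'B0 _ _ ((hp₂ _).1 k.2), hAB0 _ _ (hnp₁ i.1) (hnp₁ k.1) ((hp₂ _).1 k.2),
          MvPolynomial.totalDegree_C]))
      (fun l j => hN'deg l j) i j
  /- `per = C c · det L` with `c ≠ 0` -/
  set c : ℂ := ((Equiv.Perm.sign τ₀ : ℤ) : ℂ) * S₁.det * S₂.det with hc
  have hcne : c ≠ 0 := by
    refine mul_ne_zero (mul_ne_zero ?_ hS₁ne) hS₂ne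
    rcases Int.units_eq_one_or (Equiv.Perm.sign τ₀) with h | h <;> simp [h]
  have hsignsq : ((Equiv.Perm.sign τ₀ : ℤ) : MvPolynomial (Fin (n + 3) × Fin (n + 3)) ℂ) *
      ((Equiv.Perm.sign τ₀ : ℤ) : MvPolynomial (Fin (n + 3) × Fin (n + 3)) ℂ) = 1 := by
    rw [← Int.cast_mul, ← Units.val_mul, Int.units_mul_self, Units.val_one, Int.cast_one]
  have hperL : Literature.Computability.AlgebraicComplexity.perPoly (Fin (n + 3)) ℂ =
      MvPolynomial.C c * L.det := by
    have h1 : M.det = ((Equiv.Perm.sign τ₀ : ℤ) : MvPolynomial (Fin (n + 3) × Fin (n + 3)) ℂ) *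
        M₁.det := by
      rw [hdet₁, ← mul_assoc, hsignsq, one_mul]
    rw [← hdetM, h1, hstep1, hstep2, hc, map_mul, map_mul,
      ← map_intCast (MvPolynomial.C : ℂ →+* MvPolynomial (Fin (n + 3) × Fin (n + 3)) ℂ)]
    ring
  /- reindex `L` to `Fin (n+3)` and scale a row: an affine determinantal representation of size `n+3` -/
  have hcardA : Fintype.card {i : {i // ¬ p₁ i} // ¬ p₂ i} = n + 3 := by
    have e₃ : {i : {i // ¬ p₁ i} // ¬ p₂ i} ≃
        {i : Fin m // ∃ k, a (i, τ₀ i) = MvPolynomial.X k} :=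
      { toFun := fun x => ⟨x.1.1, Classical.not_not.1 fun h => x.2 ((hp₂ x.1).2 h)⟩
        invFun := fun y => ⟨⟨y.1, fun h => (hp₁ _).1 h (hlev τ₀ hτ₀ y.1 y.2)⟩,
          fun h => (hp₂ _).1 h y.2⟩
        left_inv := fun x => rfl
        right_inv := fun y => rfl }
    rw [Fintype.card_congr e₃, Fintype.card_subtype, card_var_eq E a ha hper τ₀ hτ₀]
  have e₄ : {i : {i // ¬ p₁ i} // ¬ p₂ i} ≃ Fin (n + 3) := Fintype.equivFinOfCardEq hcardA
  set F₀ : Matrix (Fin (n + 3)) (Fin (n + 3)) (MvPolynomial (Fin (n + 3) × Fin (n + 3)) ℂ) :=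
    L.submatrix e₄.symm e₄.symm with hF₀
  have hF₀det : F₀.det = L.det := Matrix.det_submatrix_equiv_self e₄.symm L
  set F : Matrix (Fin (n + 3)) (Fin (n + 3)) (MvPolynomial (Fin (n + 3) × Fin (n + 3)) ℂ) :=
    F₀.updateRow 0 ((MvPolynomial.C c : MvPolynomial (Fin (n + 3) × Fin (n + 3)) ℂ) • F₀ 0) with hF
  have hFdet : F.det = MvPolynomial.C c * F₀.det := by
    rw [hF, Matrix.det_updateRow_smul, Matrix.updateRow_eq_self]
  have hFdeg : ∀ i j, (F i j).totalDegree ≤ 1 := by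
    intro i j
    by_cases hi : i = 0
    · subst hi
      rw [hF, Matrix.updateRow_self, Pi.smul_apply, smul_eq_mul]
      calc (MvPolynomial.C c * F₀ 0 j).totalDegree
          ≤ (MvPolynomial.C c : MvPolynomial (Fin (n + 3) × Fin (n + 3)) ℂ).totalDegree +
            (F₀ 0 j).totalDegree := MvPolynomial.totalDegree_mul _ _
        _ ≤ 0 + 1 := Nat.add_le_add (le_of_eq (MvPolynomial.totalDegree_C _))
            (by rw [hF₀, Matrix.submatrix_apply]; exact hLdeg _ _)
        _ = 1 := rfl
    · rw [hF, Matrix.updateRow_ne hi, hF₀, Matrix.submatrix_apply]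
      exact hLdeg _ _
  have hrepr : HasDetRepr (Literature.Computability.AlgebraicComplexity.perPoly (Fin (n + 3)) ℂ)
      (n + 3) :=
    ⟨F, fun i j => hFdeg i j, by rw [hFdet, hF₀det, ← hperL]⟩
  have hsq := sq_le_two_mul_of_hasDetRepr_perPoly hrepr
  nlinarith

end Summit.ValiantsHypothesis.ValiantsHypothesis.Theorems.PolyaContinuedMonotoneCoverHard
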